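import Mathlib

/-!
HONEST FRAMING: exact (Metropolis-corrected) sampling algorithms for lattice gauge theory; figures
of merit are autocorrelation/cost numbers at stated couplings and volumes; no continuum-physics
claim.

# ClockConditionedRenewal — THE RENEWAL SEQUENCE OF THE CLOCK-CONDITIONED COUPLING: FOR `u_n = Σ_{j<n}σʲ(1−σ)(1−r_j)u_{n−1−j} + σⁿ` WITH RATES `r_j ∈ [0,1]` AVERAGING TO `r̃`
# (`Σ_{j<n}σʲ(1−σ)(1−r_j) ≤ 1 − r̃`), `u_n ≤ (1−r̃)ᵏ + B_k(n)` FOR EVERY `k` WITH `B_k(n) ≤ (2ᵏ⁺¹−1)((1+σ)/2)ⁿ` (THE CHANCE OF FEWER THAN `k` REDRAWS IN `n` STEPS); FOR SIGNED RATES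
# `−q ≤ r_j ≤ 1`, `u_n ≤ (2/r̃)·(1 + (1−σ)r̃/(8(1+q)))⁻ⁿ` (lean-2 GEN-39, ours)

Venture-side (OURS).  Cell `lqcd-flow` (pub-lqcd), unit `pub-lqcd-lean-2-g39`, 2026-08-30.  Chapter Y, file C2 — the real-sequence half of the clock-conditioned cycle → step transfer
(file C1 `ClockConditionedContraction`: `‖Sⁿ(x,·) − Sⁿ(y,·)‖_TV ≤ u_n·ρ(x,y)`, `d_S(n) ≤ D·u_n`).  Probabilistically `u_n = E[Π_{cycles completed by time n}(1−r_{j_i})]` for the i.i.d.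
`Bernoulli(1−σ)` redraw clock; this file bounds it WITHOUT probability, from the recursion alone:

* NON-NEGATIVE RATES (`0 ≤ r_j ≤ 1`, `Σ_{j<n}σʲ(1−σ)(1−r_j) ≤ 1−r̃` for all `n`): `u_n ≤ 1` and, for every `k`, **`u_n ≤ (1−r̃)ᵏ + B_k(n)`** where `B` is the "fewer than `k` redraws" sequence
  `B_0 = 0`, `B_{k+1}(n) = Σ_{j<n}σʲ(1−σ)B_k(n−1−j) + σⁿ` (`renewal_le_pow_add_tail`), and **`B_k(n) ≤ (2ᵏ⁺¹ − 1)·((1+σ)/2)ⁿ`** (`renewal_tail_le`); so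
  `u_n ≤ (1−r̃)ᵏ + (2ᵏ⁺¹−1)((1+σ)/2)ⁿ` — no prefactor in `1/r̃` (`renewal_le_explicit`);
* SIGNED RATES (`−q ≤ r_j ≤ 1`): the supersolution bound **`u_n ≤ γⁿ/δ`** whenever `σ ≤ γ` and the characteristic inequality `Σ_{j<n}σʲ(1−σ)(1−r_j)γ^{−(j+1)} ≤ 1 − δ` holds
  (`renewal_le_geometric`), and that inequality with `γ⁻¹ = 1 + (1−σ)r̃/(8(1+q))`, `δ = r̃/2` from the mean-rate hypothesis (`renewal_characteristic`); hence
  **`u_n ≤ (2/r̃)(1 + (1−σ)r̃/(8(1+q)))⁻ⁿ`** (`renewal_le_signed`).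

Reading (no numerics implied): with `r̃ ≍ σp̄/K` (chapter W's cycle rate) the first bound is the shape `t_mix^{steps}(ε) = O((1/((1−σ)r̃))·log(D/ε))` of OPEN-MATH (b′); the mixing-time
corollaries are file C3.  Literature grade (cell rule): OWN, elementary; nothing cited; no new bib keys.
-/

open Finset

namespace Summit.Ventures.LatticeQCDFlow.Scaling

section Renewal
variable {σ rt : ℝ} {r u : ℕ → ℝ}

/-! ### §1 Non-negative rates: `u ≤ 1`, `u_n ≤ (1−r̃)ᵏ + B_k(n)`, `B_k(n) ≤ (2ᵏ⁺¹−1)((1+σ)/2)ⁿ` -/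

/-- The geometric weights sum to `1 − σⁿ`: `Σ_{j<n}σʲ(1−σ) = 1 − σⁿ`. [ours] -/
theorem renewal_weights_sum (σ : ℝ) (n : ℕ) : ∑ j ∈ range n, σ ^ j * (1 - σ) = 1 - σ ^ n := by
  induction n with
  | zero => simp
  | succ n ih => rw [sum_range_succ, ih, pow_succ]; ring

/-- With rates in `[0,1]`: `0 ≤ u_n ≤ 1`. [ours] -/
theorem renewal_le_one (hσ0 : 0 ≤ σ) (hσ1 : σ ≤ 1) (hr0 : ∀ j, 0 ≤ r j) (hr1 : ∀ j, r j ≤ 1)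
    (hu : ∀ n, u n = (∑ j ∈ range n, σ ^ j * (1 - σ) * (1 - r j) * u (n - 1 - j)) + σ ^ n) (n : ℕ) : 0 ≤ u n ∧ u n ≤ 1 := by
  induction n using Nat.strong_induction_on with
  | _ n ih =>
      rw [hu n]
      refine ⟨add_nonneg (sum_nonneg fun j hj => ?_) (pow_nonneg hσ0 n), ?_⟩
      · have := mem_range.mp hj
        exact mul_nonneg (mul_nonneg (mul_nonneg (pow_nonneg hσ0 j) (by linarith)) (by linarith [hr1 j])) (ih _ (by omega)).1
      · calc (∑ j ∈ range n, σ ^ j * (1 - σ) * (1 - r j) * u (n - 1 - j)) + σ ^ n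
            ≤ (∑ j ∈ range n, σ ^ j * (1 - σ)) + σ ^ n := by
              refine add_le_add (sum_le_sum fun j hj => ?_) le_rfl
              have hjn := mem_range.mp hj
              have h1 : 0 ≤ σ ^ j * (1 - σ) := mul_nonneg (pow_nonneg hσ0 j) (by linarith)
              have hu0 := (ih (n - 1 - j) (by omega)).1
              have hu1 := (ih (n - 1 - j) (by omega)).2
              have h2 : (1 - r j) * u (n - 1 - j) ≤ 1 := by nlinarith [hr0 j, hr1 j]
              calc σ ^ j * (1 - σ) * (1 - r j) * u (n - 1 - j) = σ ^ j * (1 - σ) * ((1 - r j) * u (n - 1 - j)) := by ring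
                _ ≤ σ ^ j * (1 - σ) * 1 := mul_le_mul_of_nonneg_left h2 h1
                _ = σ ^ j * (1 - σ) := mul_one _
          _ = 1 := by rw [renewal_weights_sum]; ring

/-- The "fewer than `k` redraws" sequence is in `[0,1]` too (it is `u` with all rates zero, shifted): `0 ≤ B_k(n)`. [ours] -/
theorem renewal_tail_nonneg (hσ0 : 0 ≤ σ) (hσ1 : σ ≤ 1) {Bk : ℕ → ℕ → ℝ} (hB0 : ∀ n, Bk 0 n = 0)
    (hBs : ∀ k n, Bk (k + 1) n = (∑ j ∈ range n, σ ^ j * (1 - σ) * Bk k (n - 1 - j)) + σ ^ n) (k n : ℕ) : 0 ≤ Bk k n := by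
  induction k generalizing n with
  | zero => rw [hB0]
  | succ k ih =>
      rw [hBs]
      exact add_nonneg (sum_nonneg fun j _ => mul_nonneg (mul_nonneg (pow_nonneg hσ0 j) (by linarith)) (ih _)) (pow_nonneg hσ0 n)

/-- **`u_n ≤ (1−r̃)ᵏ + B_k(n)` for every `k`** (rates in `[0,1]` with `Σ_{j<n}σʲ(1−σ)(1−r_j) ≤ 1 − r̃` for all `n`, `r̃ ≤ 1`). [ours] -/
theorem renewal_le_pow_add_tail (hσ0 : 0 ≤ σ) (hσ1 : σ ≤ 1) (hr0 : ∀ j, 0 ≤ r j) (hr1 : ∀ j, r j ≤ 1) (hrt1 : rt ≤ 1)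
    (hmean : ∀ n, ∑ j ∈ range n, σ ^ j * (1 - σ) * (1 - r j) ≤ 1 - rt)
    (hu : ∀ n, u n = (∑ j ∈ range n, σ ^ j * (1 - σ) * (1 - r j) * u (n - 1 - j)) + σ ^ n)
    {Bk : ℕ → ℕ → ℝ} (hB0 : ∀ n, Bk 0 n = 0) (hBs : ∀ k n, Bk (k + 1) n = (∑ j ∈ range n, σ ^ j * (1 - σ) * Bk k (n - 1 - j)) + σ ^ n)
    (k n : ℕ) : u n ≤ (1 - rt) ^ k + Bk k n := by
  induction k generalizing n with
  | zero => rw [pow_zero, hB0, add_zero]; exact (renewal_le_one hσ0 hσ1 hr0 hr1 hu n).2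
  | succ k ih =>
      rw [hu n, hBs]
      have hw : ∀ j, 0 ≤ σ ^ j * (1 - σ) * (1 - r j) := fun j => mul_nonneg (mul_nonneg (pow_nonneg hσ0 j) (by linarith)) (by linarith [hr1 j])
      calc (∑ j ∈ range n, σ ^ j * (1 - σ) * (1 - r j) * u (n - 1 - j)) + σ ^ n
          ≤ (∑ j ∈ range n, σ ^ j * (1 - σ) * (1 - r j) * ((1 - rt) ^ k + Bk k (n - 1 - j))) + σ ^ n :=
            add_le_add (sum_le_sum fun j _ => mul_le_mul_of_nonneg_left (ih _) (hw j)) le_rfl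
        _ = (∑ j ∈ range n, σ ^ j * (1 - σ) * (1 - r j)) * (1 - rt) ^ k
              + ((∑ j ∈ range n, σ ^ j * (1 - σ) * (1 - r j) * Bk k (n - 1 - j)) + σ ^ n) := by
            rw [sum_mul, ← add_assoc, ← sum_add_distrib]; exact congrArg₂ _ (sum_congr rfl fun j _ => by ring) rfl
        _ ≤ (1 - rt) * (1 - rt) ^ k + ((∑ j ∈ range n, σ ^ j * (1 - σ) * Bk k (n - 1 - j)) + σ ^ n) := by
            refine add_le_add (mul_le_mul_of_nonneg_right (hmean n) (pow_nonneg (by linarith) k)) (add_le_add (sum_le_sum fun j _ => ?_) le_rfl)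
            have hB := renewal_tail_nonneg hσ0 hσ1 hB0 hBs k (n - 1 - j)
            calc σ ^ j * (1 - σ) * (1 - r j) * Bk k (n - 1 - j) ≤ σ ^ j * (1 - σ) * 1 * Bk k (n - 1 - j) :=
                  mul_le_mul_of_nonneg_right (mul_le_mul_of_nonneg_left (by linarith [hr0 j]) (mul_nonneg (pow_nonneg hσ0 j) (by linarith))) hB
              _ = σ ^ j * (1 - σ) * Bk k (n - 1 - j) := by ring
        _ = (1 - rt) ^ (k + 1) + ((∑ j ∈ range n, σ ^ j * (1 - σ) * Bk k (n - 1 - j)) + σ ^ n) := by rw [pow_succ]; ring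

/-- A finite geometric sum below `1`: `Σ_{j<n} xʲ ≤ 1/(1−x)` for `0 ≤ x < 1`. [ours] -/
private theorem renewal_geom_sum_le {x : ℝ} (hx0 : 0 ≤ x) (hx1 : x < 1) (n : ℕ) : ∑ j ∈ range n, x ^ j ≤ 1 / (1 - x) := by
  have h := renewal_weights_sum x n
  have hs : ∑ j ∈ range n, x ^ j * (1 - x) = (∑ j ∈ range n, x ^ j) * (1 - x) := by rw [sum_mul]
  rw [hs] at h
  rw [le_div_iff₀ (by linarith), h]
  linarith [pow_nonneg hx0 n]

/-- **The redraw-count tail:** `B_k(n) ≤ (2ᵏ⁺¹ − 1)·((1+σ)/2)ⁿ` for `0 ≤ σ < 1` (a Chernoff bound for `P{Bin(n,1−σ) < k}`, proved from the recursion). [ours] -/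
theorem renewal_tail_le (hσ0 : 0 ≤ σ) (hσ1 : σ < 1) {Bk : ℕ → ℕ → ℝ} (hB0 : ∀ n, Bk 0 n = 0)
    (hBs : ∀ k n, Bk (k + 1) n = (∑ j ∈ range n, σ ^ j * (1 - σ) * Bk k (n - 1 - j)) + σ ^ n) (k n : ℕ) :
    Bk k n ≤ (2 ^ (k + 1) - 1) * ((1 + σ) / 2) ^ n := by
  obtain ⟨lam, hlam⟩ : ∃ lam : ℝ, lam = (1 + σ) / 2 := ⟨_, rfl⟩
  rw [← hlam]
  have hl0 : 0 < lam := by rw [hlam]; linarith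
  have hl1 : lam ≤ 1 := by rw [hlam]; linarith
  have hσl : σ ≤ lam := by rw [hlam]; linarith
  have hxl : σ / lam < 1 := by rw [div_lt_one hl0, hlam]; linarith
  have hx0 : 0 ≤ σ / lam := div_nonneg hσ0 hl0.le
  have e1 : 1 - σ / lam = (1 - σ) / (2 * lam) := by rw [hlam]; field_simp; ring
  induction k generalizing n with
  | zero => rw [hB0]; exact mul_nonneg (by norm_num) (pow_nonneg hl0.le n)
  | succ k ih =>
      rw [hBs]
      -- `σʲ·λ^{n−1−j} = λ^{n−1}(σ/λ)ʲ` for `j < n`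
      have key : ∀ j ∈ range n, σ ^ j * (1 - σ) * Bk k (n - 1 - j) ≤ (2 ^ (k + 1) - 1) * (1 - σ) * lam ^ (n - 1) * (σ / lam) ^ j := by
        intro j hj
        have hjn := mem_range.mp hj
        have h1 : σ ^ j * (1 - σ) * Bk k (n - 1 - j) ≤ σ ^ j * (1 - σ) * ((2 ^ (k + 1) - 1) * lam ^ (n - 1 - j)) :=
          mul_le_mul_of_nonneg_left (ih _) (mul_nonneg (pow_nonneg hσ0 j) (by linarith))
        have h2 : σ ^ j * lam ^ (n - 1 - j) = lam ^ (n - 1) * (σ / lam) ^ j := by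
          have hl : lam ^ (n - 1) = lam ^ (n - 1 - j) * lam ^ j := by rw [← pow_add]; congr 1; omega
          rw [hl, div_pow, mul_div_assoc', eq_div_iff (pow_ne_zero _ hl0.ne')]; ring
        calc σ ^ j * (1 - σ) * Bk k (n - 1 - j) ≤ σ ^ j * (1 - σ) * ((2 ^ (k + 1) - 1) * lam ^ (n - 1 - j)) := h1
          _ = (2 ^ (k + 1) - 1) * (1 - σ) * (σ ^ j * lam ^ (n - 1 - j)) := by ring
          _ = (2 ^ (k + 1) - 1) * (1 - σ) * lam ^ (n - 1) * (σ / lam) ^ j := by rw [h2]; ring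
      have hgeom := renewal_geom_sum_le hx0 hxl n
      have h2k : (0 : ℝ) ≤ 2 ^ (k + 1) - 1 := by
        have : (1 : ℝ) ≤ 2 ^ (k + 1) := one_le_pow₀ (by norm_num)
        linarith
      have hc0 : 0 ≤ (2 ^ (k + 1) - 1) * (1 - σ) * lam ^ (n - 1) := mul_nonneg (mul_nonneg h2k (by linarith)) (pow_nonneg hl0.le _)
      have hpow : lam ^ (n - 1) * lam ≤ lam ^ n := by
        rw [← pow_succ]; exact pow_le_pow_of_le_one hl0.le hl1 (by omega)
      have hσne : (1 - σ) ≠ 0 := by linarith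
      have e3 : (2 ^ (k + 1) - 1) * (1 - σ) * lam ^ (n - 1) * (1 / ((1 - σ) / (2 * lam))) = (2 ^ (k + 1) - 1) * 2 * (lam ^ (n - 1) * lam) := by
        rw [one_div_div]; field_simp
      calc (∑ j ∈ range n, σ ^ j * (1 - σ) * Bk k (n - 1 - j)) + σ ^ n
          ≤ (∑ j ∈ range n, (2 ^ (k + 1) - 1) * (1 - σ) * lam ^ (n - 1) * (σ / lam) ^ j) + lam ^ n :=
            add_le_add (sum_le_sum key) (pow_le_pow_left₀ hσ0 hσl n)
        _ = (2 ^ (k + 1) - 1) * (1 - σ) * lam ^ (n - 1) * (∑ j ∈ range n, (σ / lam) ^ j) + lam ^ n := by rw [mul_sum]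
        _ ≤ (2 ^ (k + 1) - 1) * (1 - σ) * lam ^ (n - 1) * (1 / (1 - σ / lam)) + lam ^ n := add_le_add (mul_le_mul_of_nonneg_left hgeom hc0) le_rfl
        _ = (2 ^ (k + 1) - 1) * 2 * (lam ^ (n - 1) * lam) + lam ^ n := by rw [e1, e3]
        _ ≤ (2 ^ (k + 1) - 1) * 2 * lam ^ n + lam ^ n := add_le_add (mul_le_mul_of_nonneg_left hpow (mul_nonneg h2k (by norm_num))) le_rfl
        _ = (2 ^ (k + 1 + 1) - 1) * lam ^ n := by rw [pow_succ (2 : ℝ) (k + 1)]; ring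

/-- **Explicit form:** `u_n ≤ (1−r̃)ᵏ + (2ᵏ⁺¹ − 1)((1+σ)/2)ⁿ` for every `k` (rates in `[0,1]`, mean rate `r̃`, `0 ≤ σ < 1`); the tail sequence is supplied by its recursion. [ours] -/
theorem renewal_le_explicit (hσ0 : 0 ≤ σ) (hσ1 : σ < 1) (hr0 : ∀ j, 0 ≤ r j) (hr1 : ∀ j, r j ≤ 1) (hrt1 : rt ≤ 1)
    (hmean : ∀ n, ∑ j ∈ range n, σ ^ j * (1 - σ) * (1 - r j) ≤ 1 - rt)
    (hu : ∀ n, u n = (∑ j ∈ range n, σ ^ j * (1 - σ) * (1 - r j) * u (n - 1 - j)) + σ ^ n)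
    {Bk : ℕ → ℕ → ℝ} (hB0 : ∀ n, Bk 0 n = 0) (hBs : ∀ k n, Bk (k + 1) n = (∑ j ∈ range n, σ ^ j * (1 - σ) * Bk k (n - 1 - j)) + σ ^ n)
    (k n : ℕ) : u n ≤ (1 - rt) ^ k + (2 ^ (k + 1) - 1) * ((1 + σ) / 2) ^ n :=
  (renewal_le_pow_add_tail hσ0 hσ1.le hr0 hr1 hrt1 hmean hu hB0 hBs k n).trans (add_le_add le_rfl (renewal_tail_le hσ0 hσ1 hB0 hBs k n))

/-! ### §2 Signed rates: the supersolution bound and the characteristic inequality -/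

/-- **Supersolution bound:** if `σ ≤ γ`, `0 < γ`, `0 < δ`, `r ≤ 1`, and the characteristic inequality `Σ_{j<n}σʲ(1−σ)(1−r_j)(γ⁻¹)ʲ⁺¹ ≤ 1 − δ` holds for every `n`, then `u_n ≤ γⁿ/δ`. [ours] -/
theorem renewal_le_geometric (hσ0 : 0 ≤ σ) {γ δ : ℝ} (hγ0 : 0 < γ) (hσγ : σ ≤ γ) (hδ : 0 < δ) (hr1 : ∀ j, r j ≤ 1)
    (hchar : ∀ n, ∑ j ∈ range n, σ ^ j * (1 - σ) * (1 - r j) * (γ⁻¹) ^ (j + 1) ≤ 1 - δ)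
    (hu : ∀ n, u n = (∑ j ∈ range n, σ ^ j * (1 - σ) * (1 - r j) * u (n - 1 - j)) + σ ^ n) (hσ1 : σ ≤ 1) (n : ℕ) : u n ≤ γ ^ n / δ := by
  induction n using Nat.strong_induction_on with
  | _ n ih =>
      rw [hu n]
      have hw : ∀ j, 0 ≤ σ ^ j * (1 - σ) * (1 - r j) := fun j => mul_nonneg (mul_nonneg (pow_nonneg hσ0 j) (by linarith)) (by linarith [hr1 j])
      -- `γ^{n−1−j}/δ = (γⁿ/δ)·(γ⁻¹)^{j+1}` for `j < n`
      have e : ∀ j ∈ range n, σ ^ j * (1 - σ) * (1 - r j) * (γ ^ (n - 1 - j) / δ) = (γ ^ n / δ) * (σ ^ j * (1 - σ) * (1 - r j) * (γ⁻¹) ^ (j + 1)) := by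
        intro j hj
        have hjn := mem_range.mp hj
        have : γ ^ n = γ ^ (n - 1 - j) * γ ^ (j + 1) := by rw [← pow_add]; congr 1; omega
        rw [this, inv_pow]
        field_simp
      calc (∑ j ∈ range n, σ ^ j * (1 - σ) * (1 - r j) * u (n - 1 - j)) + σ ^ n
          ≤ (∑ j ∈ range n, σ ^ j * (1 - σ) * (1 - r j) * (γ ^ (n - 1 - j) / δ)) + σ ^ n :=
            add_le_add (sum_le_sum fun j hj => mul_le_mul_of_nonneg_left (ih (n - 1 - j) (by have h := mem_range.mp hj; omega)) (hw j)) le_rfl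
        _ = (γ ^ n / δ) * (∑ j ∈ range n, σ ^ j * (1 - σ) * (1 - r j) * (γ⁻¹) ^ (j + 1)) + σ ^ n := by rw [sum_congr rfl e, mul_sum]
        _ ≤ (γ ^ n / δ) * (1 - δ) + γ ^ n := add_le_add (mul_le_mul_of_nonneg_left (hchar n) (div_nonneg (pow_nonneg hγ0.le n) hδ.le)) (pow_le_pow_left₀ hσ0 hσγ n)
        _ = γ ^ n / δ := by field_simp; ring

/-- **The characteristic inequality from the mean rate (signed rates):** with `0 ≤ σ < 1`, `0 < r̃ ≤ 1`, `0 ≤ q`, `−q ≤ r_j ≤ 1`, `Σ_{j<n}σʲ(1−σ)(1−r_j) ≤ 1 − r̃` (all `n`), and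
`ε = (1−σ)r̃/(8(1+q))`: `Σ_{j<n}σʲ(1−σ)(1−r_j)(1+ε)ʲ⁺¹ ≤ 1 − r̃/2` for every `n`, and `σ(1+ε) ≤ 1`. [ours] -/
theorem renewal_characteristic (hσ0 : 0 ≤ σ) (hσ1 : σ < 1) (hrt0 : 0 < rt) (hrt1 : rt ≤ 1) {q : ℝ} (hq : 0 ≤ q)
    (hrq : ∀ j, -q ≤ r j) (hr1 : ∀ j, r j ≤ 1) (hmean : ∀ n, ∑ j ∈ range n, σ ^ j * (1 - σ) * (1 - r j) ≤ 1 - rt)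
    {ε : ℝ} (hε : ε = (1 - σ) * rt / (8 * (1 + q))) (n : ℕ) :
    (∑ j ∈ range n, σ ^ j * (1 - σ) * (1 - r j) * (1 + ε) ^ (j + 1) ≤ 1 - rt / 2) ∧ σ * (1 + ε) ≤ 1 := by
  have hq1 : 0 < 1 + q := by linarith
  have hε0 : 0 ≤ ε := by rw [hε]; exact div_nonneg (mul_nonneg (by linarith) hrt0.le) (by linarith)
  have hεle : ε ≤ (1 - σ) / 8 := by
    rw [hε, div_le_div_iff₀ (by linarith) (by norm_num : (0:ℝ) < 8)]
    have : (1 - σ) * rt * 8 ≤ (1 - σ) * 8 * (1 + q) := by nlinarith [mul_nonneg (by linarith : (0:ℝ) ≤ 1 - σ) hq, mul_nonneg (by linarith : (0:ℝ) ≤ 1 - σ) hrt0.le]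
    linarith
  set x : ℝ := σ * (1 + ε) with hx
  have hx0 : 0 ≤ x := mul_nonneg hσ0 (by linarith)
  have hx1 : x < 1 := by
    rw [hx]; nlinarith [mul_nonneg hσ0 hε0]
  have hxσ : 1 - x ≥ (1 - σ) * (7 / 8) := by rw [hx]; nlinarith [mul_nonneg hσ0 hε0]
  refine ⟨?_, hx1.le⟩
  -- split `(1+ε)^{j+1} = 1 + ((1+ε)^{j+1} − 1)` and bound the second part with `1 − r_j ≤ 1 + q`
  have hw : ∀ j, 0 ≤ σ ^ j * (1 - σ) * (1 - r j) := fun j => mul_nonneg (mul_nonneg (pow_nonneg hσ0 j) (by linarith)) (by linarith [hr1 j])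
  have hsplit : ∑ j ∈ range n, σ ^ j * (1 - σ) * (1 - r j) * (1 + ε) ^ (j + 1)
      = (∑ j ∈ range n, σ ^ j * (1 - σ) * (1 - r j)) + ∑ j ∈ range n, σ ^ j * (1 - σ) * (1 - r j) * ((1 + ε) ^ (j + 1) - 1) := by
    rw [← sum_add_distrib]; exact sum_congr rfl fun j _ => by ring
  have hpart : ∑ j ∈ range n, σ ^ j * (1 - σ) * (1 - r j) * ((1 + ε) ^ (j + 1) - 1) ≤ (1 + q) * ((1 - σ) * ∑ j ∈ range n, (σ ^ j * (1 + ε) ^ (j + 1) - σ ^ j)) := by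
    rw [mul_sum, mul_sum]
    refine sum_le_sum fun j _ => ?_
    have hge : 0 ≤ (1 + ε) ^ (j + 1) - 1 := by linarith [one_le_pow₀ (by linarith : (1:ℝ) ≤ 1 + ε) (n := j + 1)]
    calc σ ^ j * (1 - σ) * (1 - r j) * ((1 + ε) ^ (j + 1) - 1) ≤ σ ^ j * (1 - σ) * (1 + q) * ((1 + ε) ^ (j + 1) - 1) :=
          mul_le_mul_of_nonneg_right (mul_le_mul_of_nonneg_left (by linarith [hrq j]) (mul_nonneg (pow_nonneg hσ0 j) (by linarith))) hge
      _ = (1 + q) * ((1 - σ) * (σ ^ j * (1 + ε) ^ (j + 1) - σ ^ j)) := by ring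
  -- the two geometric sums in closed form: `Σ xʲ(1−x) = 1 − xⁿ`, `Σ σʲ(1−σ) = 1 − σⁿ`
  have hxpos : 0 < 1 - x := by linarith
  have hgeo : (1 - σ) * ∑ j ∈ range n, (σ ^ j * (1 + ε) ^ (j + 1) - σ ^ j) ≤ ε / (1 - x) := by
    have e1 : ∑ j ∈ range n, (σ ^ j * (1 + ε) ^ (j + 1) - σ ^ j) = (1 + ε) * ∑ j ∈ range n, x ^ j - ∑ j ∈ range n, σ ^ j := by
      rw [mul_sum, ← sum_sub_distrib]; exact sum_congr rfl fun j _ => by rw [hx, mul_pow, pow_succ]; ring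
    have gx : (∑ j ∈ range n, x ^ j) * (1 - x) = 1 - x ^ n := by rw [sum_mul]; exact renewal_weights_sum x n
    have gσ : (∑ j ∈ range n, σ ^ j) * (1 - σ) = 1 - σ ^ n := by rw [sum_mul]; exact renewal_weights_sum σ n
    have hxn : σ ^ n ≤ x ^ n := pow_le_pow_left₀ hσ0 (by rw [hx]; nlinarith [mul_nonneg hσ0 hε0]) n
    have hxn1 : x ^ n ≤ 1 := pow_le_one₀ hx0 hx1.le
    have hxε : (1 - σ) * (1 + ε) = (1 - x) + ε := by rw [hx]; ring
    rw [e1, le_div_iff₀ hxpos]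
    calc (1 - σ) * ((1 + ε) * ∑ j ∈ range n, x ^ j - ∑ j ∈ range n, σ ^ j) * (1 - x)
        = (1 - σ) * (1 + ε) * ((∑ j ∈ range n, x ^ j) * (1 - x)) - ((∑ j ∈ range n, σ ^ j) * (1 - σ)) * (1 - x) := by ring
      _ = ((1 - x) + ε) * (1 - x ^ n) - (1 - σ ^ n) * (1 - x) := by rw [hxε, gx, gσ]
      _ = (1 - x) * (σ ^ n - x ^ n) + ε * (1 - x ^ n) := by ring
      _ ≤ ε := by nlinarith [mul_nonneg hxpos.le (sub_nonneg.mpr hxn), mul_nonneg hε0 (pow_nonneg hx0 n)]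
  have hfin : (1 + q) * (ε / (1 - x)) ≤ rt / 7 := by
    rw [hε]
    have h78 : 0 < (1 - σ) * (7 / 8) := by nlinarith
    have hσne : 1 - σ ≠ 0 := by linarith
    calc (1 + q) * ((1 - σ) * rt / (8 * (1 + q)) / (1 - x)) = ((1 - σ) * rt / 8) / (1 - x) := by field_simp
      _ ≤ ((1 - σ) * rt / 8) / ((1 - σ) * (7 / 8)) := div_le_div_of_nonneg_left (by positivity) h78 hxσ
      _ = rt / 7 := by field_simp
  rw [hsplit]
  have := hmean n
  nlinarith [hpart, hgeo, hfin, mul_le_mul_of_nonneg_left hgeo hq1.le]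

/-- **Signed-rate bound:** under the hypotheses of `renewal_characteristic`, `u_n ≤ (2/r̃)·(1+ε)⁻ⁿ` with `ε = (1−σ)r̃/(8(1+q))`. [ours] -/
theorem renewal_le_signed (hσ0 : 0 ≤ σ) (hσ1 : σ < 1) (hrt0 : 0 < rt) (hrt1 : rt ≤ 1) {q : ℝ} (hq : 0 ≤ q)
    (hrq : ∀ j, -q ≤ r j) (hr1 : ∀ j, r j ≤ 1) (hmean : ∀ n, ∑ j ∈ range n, σ ^ j * (1 - σ) * (1 - r j) ≤ 1 - rt)
    (hu : ∀ n, u n = (∑ j ∈ range n, σ ^ j * (1 - σ) * (1 - r j) * u (n - 1 - j)) + σ ^ n)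
    {ε : ℝ} (hε : ε = (1 - σ) * rt / (8 * (1 + q))) (n : ℕ) : u n ≤ (2 / rt) * ((1 + ε)⁻¹) ^ n := by
  have hε0 : 0 ≤ ε := by rw [hε]; exact div_nonneg (mul_nonneg (by linarith) hrt0.le) (by linarith)
  have hγ0 : 0 < (1 + ε)⁻¹ := inv_pos.mpr (by linarith)
  have hch := fun n => renewal_characteristic hσ0 hσ1 hrt0 hrt1 hq hrq hr1 hmean hε n
  have hσγ : σ ≤ (1 + ε)⁻¹ := by rw [inv_eq_one_div, le_div_iff₀ (by linarith)]; exact (hch 0).2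
  have hchar : ∀ n, ∑ j ∈ range n, σ ^ j * (1 - σ) * (1 - r j) * (((1 + ε)⁻¹)⁻¹) ^ (j + 1) ≤ 1 - rt / 2 := by
    intro n; rw [inv_inv]; exact (hch n).1
  have h := renewal_le_geometric hσ0 hγ0 hσγ (by linarith : 0 < rt / 2) hr1 hchar hu hσ1.le n
  rw [div_div_eq_mul_div] at h
  calc u n ≤ (1 + ε)⁻¹ ^ n * 2 / rt := h
    _ = 2 / rt * (1 + ε)⁻¹ ^ n := by ring

end Renewal

end Summit.Ventures.LatticeQCDFlow.Scaling
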